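import Summits.QuantumFields.YangMills.Theorems.UnitScaleTiltProp7InterpErrorNearRow
import HarnessLib

/-!
# Route `UnitScaleTilt`, crux K1 «MinimiserStabilityRegPr» (stmt-QuantumFields-19200), route-R E′ path (α′), (E1-b), row (hK₂) — ABSTRACT EXPORTS OF THE PIN ROWS
# (px11 g3 LOCATE #57 §5 ASK 1 ∕ ★routeR-w3 g6 WORD (10)): the CHARGE IDENTITY at a centre for ANY real field and cutoff, and the NEAR ROW for ANY real field whose
# Laplacian is CONSTANT on a punctured ball — with the charge `q`, the constant `κ` and the ball mass `𝓜` DISPLAYED, so the covariant (hK₂-cov) chain instantiates them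
# ENTRYWISE on its framed field instead of re-typing the flat proofs

Cell `ym3-torus`, width seat `ym3-torus-px7` (gen 3); the flat (hK₂-W) chain is ✓p669609 ✓p670170 ✓p671190 ✓p671920 ✓p672645 (these are their (Q)∕(PIN) cores with the data
abstracted).  `--supports stmt-QuantumFields-19200`, count-neutral.  THEOREMS ONLY (0 `def`, 0 `sorry`).  YM₃ on T³ is a ladder rung (R3), not the Clay problem; nothing here
claims the stub, the crux, d = 4 or the gap.

WHAT IS PROVED (ns `…Theorems.Prop7InterpErrorPinAbstract`).
* §1 (Q-abs, any torus `Site P j`, any `c`) ★ `laplace_at_centre_eq_of_cutoff` — `χ y = 1 ⇒ laplace c u y = Σ_x (laplace c χ x)·u x − Σ_{x ≠ y} χ x·laplace c u x` (exact, ✓ `sum_mul_laplace_comm`);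
  ★ `abs_laplace_at_centre_le_of_cutoff` — with `|laplace c χ| ≤ B`, `|χ| ≤ 1`, `laplace c χ = 0` off a finset `S` and `χ = 0` off a finset `S′`:
  `|laplace c u y| ≤ B·√#S·√(Σ_S u²) + Σ_{S′∖{y}} |laplace c u|` (the last slot carries the covariant chain's junk `f`; at `f = 0` it is ✓ `abs_pin_reaction_le`'s core).
* §2 (PIN-abs, `P.d = 3`) `laplace_one_corrected_const` (the corrected field's Laplacian with a constant `κ`), ★★ `tdist_mul_abs_le_of_laplace_eq_const_off_centre` —
  `laplace c u = κ` on `{0 < tdist(·,y) ≤ 3(r+1)}` (`r = ρ₀ + n + 3(n+2)`, `2(r+1) < sitesPerDir 0`), `q := laplace c u y − κ`, `Σ_{tdist(z,y) ≤ 3r} u² ≤ 𝓜` ⇒ for `tdist(x,y) ≤ ρ₀`: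
  `tdist(x,y)·|u x| ≤ (|q|∕(2c²))·C₁ + tdist(x,y)·√(4K·(2𝓜 + 2(q∕(2c²))²·C_G·(3r+1)) + (4K(2r+1)³ + 2)·(64·2³·3·(|σ|(r+1)∕3)·(2r+1))²)`, `σ = (κ + q·T⁻¹)∕c²`, `K = 2³(1+56·3)³∕(n+1)³`,
  `T = (L^k·sitesPerDir k)³`, `C₁, C_G` the constants of ✓ `abs_torusGreen_EK_sub_mul_tdist_le` ∕ ✓ `sum_ball_sq_torusGreen_EK_le` (exported existentially, nonnegative).
HONEST SCOPE.  Re-plumbing of FILE 2b∕2b′ with the data abstracted; flat letters; nothing new is estimated.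

References: T. Bałaban, CMP 102 (1985) 277–309 [Balaban1985Variational] (Prop. 7 p.299); CMP 99 (1985) 75–102 [Balaban1985RegularSpaces] ((1.36) p.82).
-/

set_option autoImplicit false

noncomputable section

open scoped BigOperators

namespace Summit.QuantumFields.YangMills.Theorems.Prop7InterpErrorPinAbstract

open Literature.MathematicalPhysics.QuantumFieldTheory.Balaban1983to89
open Finset
open LatticeFieldCalculus (laplace)
open B3Taylor310LocalRemainder (tdist_comm tdist_self)
open B5Eq117TorusCarriers (EK)
open Literature.Probability.LatticeModels (torusGreen TorusSite)
open Summit.QuantumFields.YangMills.Theorems.Prop7CentreHarmonicInterpKernel (laplace_sub')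
open Summit.QuantumFields.YangMills.Theorems.Prop7GreenKernelSiteTransport (laplace_one_const_mul)
open Summit.QuantumFields.YangMills.Theorems.Prop7GreenKernelSiteFreeLaplace (laplace_one_torusGreen_EK_sub)
open Summit.QuantumFields.YangMills.Theorems.Prop7PinnedHodgeSplit (sum_mul_laplace_comm)
open Summit.QuantumFields.YangMills.Theorems.Prop7InterpErrorHarmonicLetters (laplace_eq_sq_mul_laplace_one sq_le_of_laplace_one_eq_const
  sum_ball_sq_torusGreen_EK_le abs_torusGreen_EK_sub_mul_tdist_le)

variable {P : Params} {j : ℕ}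

/-! ## §1 (Q-abs) The charge identity at a centre, for any real field and any cutoff -/

/-- ★ **THE CHARGE IDENTITY**: for any real `u`, any `χ` with `χ y = 1`:  `laplace c u y = Σ_x (laplace c χ x)·u x − Σ_{x ≠ y} χ x·laplace c u x`
(summation by parts ✓ `sum_mul_laplace_comm`, the `y`-term isolated). [cite: Balaban1985Variational, Prop. 7 p.299] -/
theorem laplace_at_centre_eq_of_cutoff (c : ℝ) (y : Site P j) (u χ : SiteField P j ℝ) (hχy : χ y = 1) :
    laplace c u y = ∑ x, laplace c χ x * u x - ∑ x ∈ Finset.univ.erase y, χ x * laplace c u x := by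
  have h := sum_mul_laplace_comm c χ u
  rw [← Finset.add_sum_erase _ _ (Finset.mem_univ y), hχy, one_mul] at h
  linarith

/-- ★ **THE CHARGE BOUND**: with `|laplace c χ| ≤ B`, `|χ| ≤ 1`, `laplace c χ = 0` off a finset `S` and `χ = 0` off a finset `S′`:
`|laplace c u y| ≤ B·(√#S·√Σ_{S} u²) + Σ_{x ∈ S′∖{y}} |laplace c u x|` (Cauchy–Schwarz on `S`; the last slot is the junk channel — zero when `u` is harmonic
on `S′∖{y}`). [cite: Balaban1985Variational, Prop. 7 p.299] -/
theorem abs_laplace_at_centre_le_of_cutoff (c : ℝ) (y : Site P j) (u χ : SiteField P j ℝ) (hχy : χ y = 1)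
    {B : ℝ} (hB : ∀ x, |laplace c χ x| ≤ B) (hχ1 : ∀ x, |χ x| ≤ 1)
    (S : Finset (Site P j)) (hS : ∀ x ∉ S, laplace c χ x = 0) (S' : Finset (Site P j)) (hS' : ∀ x ∉ S', χ x = 0) :
    |laplace c u y| ≤ B * (Real.sqrt (S.card : ℝ) * Real.sqrt (∑ x ∈ S, u x ^ 2)) + ∑ x ∈ S'.erase y, |laplace c u x| := by
  have hB0 : 0 ≤ B := (abs_nonneg _).trans (hB y)
  rw [laplace_at_centre_eq_of_cutoff c y u χ hχy]
  -- restrict both sums to the finsets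
  have h1 : ∑ x, laplace c χ x * u x = ∑ x ∈ S, laplace c χ x * u x :=
    (Finset.sum_subset (Finset.subset_univ S) fun x _ hx => by rw [hS x hx, zero_mul]).symm
  have h2 : ∑ x ∈ Finset.univ.erase y, χ x * laplace c u x = ∑ x ∈ S'.erase y, χ x * laplace c u x := by
    refine (Finset.sum_subset (Finset.erase_subset_erase y (Finset.subset_univ S')) fun x hx hx' => ?_).symm
    have hxS' : x ∉ S' := fun h => hx' (Finset.mem_erase.2 ⟨(Finset.mem_erase.1 hx).1, h⟩)
    rw [hS' x hxS', zero_mul]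
  rw [h1, h2]
  have hCS : ∑ x ∈ S, |u x| ≤ Real.sqrt (S.card : ℝ) * Real.sqrt (∑ x ∈ S, u x ^ 2) := by
    have h := Real.sum_mul_le_sqrt_mul_sqrt S (fun _ => (1 : ℝ)) (fun x => |u x|)
    simp only [one_mul, one_pow, Finset.sum_const, nsmul_eq_mul, mul_one, sq_abs] at h
    exact h
  calc |∑ x ∈ S, laplace c χ x * u x - ∑ x ∈ S'.erase y, χ x * laplace c u x|
      ≤ |∑ x ∈ S, laplace c χ x * u x| + |∑ x ∈ S'.erase y, χ x * laplace c u x| := abs_sub _ _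
    _ ≤ ∑ x ∈ S, |laplace c χ x * u x| + ∑ x ∈ S'.erase y, |χ x * laplace c u x| :=
        add_le_add (Finset.abs_sum_le_sum_abs _ _) (Finset.abs_sum_le_sum_abs _ _)
    _ ≤ ∑ x ∈ S, B * |u x| + ∑ x ∈ S'.erase y, |laplace c u x| := by
        refine add_le_add (Finset.sum_le_sum fun x _ => ?_) (Finset.sum_le_sum fun x _ => ?_)
        · rw [abs_mul]; exact mul_le_mul_of_nonneg_right (hB x) (abs_nonneg _)
        · rw [abs_mul]
          calc |χ x| * |laplace c u x| ≤ 1 * |laplace c u x| := mul_le_mul_of_nonneg_right (hχ1 x) (abs_nonneg _)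
            _ = |laplace c u x| := one_mul _
    _ = B * ∑ x ∈ S, |u x| + ∑ x ∈ S'.erase y, |laplace c u x| := by rw [Finset.mul_sum]
    _ ≤ B * (Real.sqrt (S.card : ℝ) * Real.sqrt (∑ x ∈ S, u x ^ 2)) + ∑ x ∈ S'.erase y, |laplace c u x| :=
        add_le_add (mul_le_mul_of_nonneg_left hCS hB0) le_rfl

/-! ## §2 (PIN-abs) The near row for a field with constant Laplacian on a punctured ball (`d = 3`) -/

/-- the corrected field `W = u − (q∕(2c²))·g` has `laplace 1 W = (κ + q·T⁻¹)∕c²` wherever `laplace c u = κ + q·𝟙_y` and `laplace 1 g = 2(𝟙_y − T⁻¹)`.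
[cite: Balaban1985Variational, Prop. 7 p.299] -/
theorem laplace_one_corrected_const {c T q κ : ℝ} (hc : c ≠ 0) (hT : T ≠ 0) (u g : SiteField P 0 ℝ) (y z : Site P 0)
    (hu : laplace c u z = if z = y then κ + q else κ) (hg : laplace 1 g z = 2 * ((if z = y then (1 : ℝ) else 0) - T⁻¹)) :
    laplace 1 (fun w => u w - q / (2 * c ^ 2) * g w) z = (κ + q * T⁻¹) / c ^ 2 := by
  classical
  have e1 : laplace 1 (fun w => u w - q / (2 * c ^ 2) * g w) z = laplace 1 u z - q / (2 * c ^ 2) * laplace 1 g z := by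
    rw [laplace_sub']
    dsimp only
    rw [laplace_one_const_mul]
  have e2 : laplace 1 u z = laplace c u z / c ^ 2 := by
    rw [laplace_eq_sq_mul_laplace_one c u z]; field_simp
  rw [e1, e2, hu, hg]
  split_ifs <;> field_simp <;> ring

/-- ★★ **(PIN-abs) THE NEAR ROW FOR A FIELD WITH CONSTANT LAPLACIAN ON A PUNCTURED BALL.**  `P.d = 3`, `k ≤ m + K`, `c ≠ 0`; a centre `y`, a real field `u` with
`laplace c u z = κ` for every `z ≠ y` with `tdist(z,y) ≤ 3(r+1)` (`1 ≤ n`, `r = ρ₀ + n + 3(n+2)`, `2(r+1) < sitesPerDir 0`); the CHARGE `q := laplace c u y − κ`; a MASS bound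
`Σ_{tdist(z,y) ≤ 3r} u z² ≤ 𝓜`.  Then for every `x` with `tdist(x,y) ≤ ρ₀`:
`tdist(x,y)·|u x| ≤ (|q|∕(2c²))·C₁ + tdist(x,y)·√(4K·(2𝓜 + 2(q∕(2c²))²·(C_G·(3r+1))) + (4K(2r+1)^d + 2)·(64·2^d·d·(|σ|(r+1)∕d)·(2r+1))²)`,
`σ := (κ + q·T⁻¹)∕c²`, `T := (L^k·sitesPerDir k)^d`, `K := 2^d(1+56d)^d∕(n+1)^d`, and `C₁, C_G ≥ 0` the (exported) constants of ✓ `abs_torusGreen_EK_sub_mul_tdist_le`,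
✓ `sum_ball_sq_torusGreen_EK_le` — the construction of FILE 2b′ (`W := u − (q∕(2c²))·G̃(EK y − EK ·)` has `laplace 1 W ≡ σ` on the ball; FILE 2a's sourced mean value; the
cone `|G̃(EK y − EK x)|·tdist ≤ C₁`) with `(κ, q, 𝓜)` free. [cite: Balaban1985Variational, Prop. 7 p.299; Balaban1985RegularSpaces, (1.36) p.82] -/
theorem tdist_mul_abs_le_of_laplace_eq_const_off_centre : ∃ C₁ CG : ℝ, 0 ≤ C₁ ∧ 0 ≤ CG ∧
    ∀ (P : Params) (_ : P.d = 3) (k : ℕ) (hk : k ≤ P.m + P.K) (c : ℝ) (_ : c ≠ 0) (y : Site P 0) (u : SiteField P 0 ℝ) (κ : ℝ)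
      (n ρ₀ r : ℕ) (_ : 1 ≤ n) (_ : r = ρ₀ + n + 3 * (n + 2)) (_ : 2 * (r + 1) < P.sitesPerDir 0)
      (_ : ∀ z : Site P 0, (Site.tdist z y : ℝ) ≤ 3 * ((r : ℝ) + 1) → z ≠ y → laplace c u z = κ)
      (𝓜 : ℝ) (_ : ∑ z ∈ Finset.univ.filter (fun z : Site P 0 => (Site.tdist z y : ℝ) ≤ ((3 * r : ℕ) : ℝ)), u z ^ 2 ≤ 𝓜)
      (x : Site P 0) (_ : Site.tdist x y ≤ ρ₀),
      (Site.tdist x y : ℝ) * abs (u x)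
        ≤ abs (laplace c u y - κ) / (2 * c ^ 2) * C₁
          + (Site.tdist x y : ℝ) * Real.sqrt
              (4 * ((2 : ℝ) ^ P.d * (1 + 56 * (P.d : ℝ)) ^ P.d / ((n : ℝ) + 1) ^ P.d) *
                  (2 * 𝓜 + 2 * ((laplace c u y - κ) / (2 * c ^ 2)) ^ 2 * (CG * (((3 * r : ℕ) : ℝ) + 1)))
                + (4 * ((2 : ℝ) ^ P.d * (1 + 56 * (P.d : ℝ)) ^ P.d / ((n : ℝ) + 1) ^ P.d) * (2 * (r : ℝ) + 1) ^ P.d + 2) *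
                  (64 * (2 : ℝ) ^ P.d * (P.d : ℝ) *
                      (abs ((κ + (laplace c u y - κ) * (((P.L ^ k * P.sitesPerDir k : ℕ) : ℝ) ^ P.d)⁻¹) / c ^ 2) * ((r : ℝ) + 1) / (P.d : ℝ)) *
                    (2 * (r : ℝ) + 1)) ^ 2) := by
  obtain ⟨C₁, hC₁, hG1⟩ := abs_torusGreen_EK_sub_mul_tdist_le
  obtain ⟨CG, hCG, hGsum⟩ := sum_ball_sq_torusGreen_EK_le
  refine ⟨C₁, CG, hC₁, hCG, ?_⟩
  intro P hd k hk c hc y u κ n ρ₀ r hn hr hN hu 𝓜 hM x hx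
  classical
  have hd3 : (P.d : ℝ) = 3 := by exact_mod_cast hd
  have hd1 : 1 ≤ P.d := P.hd
  have hc2 : 0 < c ^ 2 := by positivity
  have ht0 : (0 : ℝ) ≤ Site.tdist x y := Nat.cast_nonneg _
  -- letters
  set q : ℝ := laplace c u y - κ with hq
  set T : ℝ := (((P.L ^ k * P.sitesPerDir k : ℕ) : ℝ)) ^ P.d with hT
  have hT0 : 0 < T := by
    rw [hT]; exact pow_pos (by exact_mod_cast Nat.pos_of_ne_zero (mul_ne_zero (pow_ne_zero _ P.L_pos.ne') (P.sitesPerDir_ne_zero k))) _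
  set g : SiteField P 0 ℝ := fun z => torusGreen (L := P.L ^ k * P.sitesPerDir k) (EK hk y - EK hk z) with hgdef
  set a : ℝ := q / (2 * c ^ 2) with ha
  set W : SiteField P 0 ℝ := fun z => u z - a * g z with hWdef
  set σ : ℝ := (κ + q * T⁻¹) / c ^ 2 with hσ
  set K : ℝ := (2 : ℝ) ^ P.d * (1 + 56 * (P.d : ℝ)) ^ P.d / ((n : ℝ) + 1) ^ P.d with hK
  have hK0 : 0 ≤ K := by rw [hK]; positivity
  -- `laplace c u = κ + q·𝟙_y` on the ball, hence `laplace 1 W ≡ σ` there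
  have hulap : ∀ z, (Site.tdist z y : ℝ) ≤ 3 * ((r : ℝ) + 1) → laplace c u z = if z = y then κ + q else κ := by
    intro z hz
    split_ifs with hzy
    · rw [hzy, hq]; ring
    · exact hu z hz hzy
  have hWlap : ∀ z, (Site.tdist z y : ℝ) ≤ (P.d : ℝ) * ((r : ℝ) + 1) → laplace 1 W z = σ := by
    intro z hz
    rw [hd3] at hz
    have e3 : laplace 1 g z = 2 * ((if z = y then (1 : ℝ) else 0) - T⁻¹) := by
      rw [hgdef, hT]; exact laplace_one_torusGreen_EK_sub hk y z
    rw [hWdef, ha, hσ]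
    exact laplace_one_corrected_const hc hT0.ne' u g y z (hulap z hz) e3
  -- FILE 2a's sourced mean value
  have hr' : r = ρ₀ + n + P.d * (n + 2) := by rw [hd]; exact hr
  have h3r : (P.d : ℝ) * r = ((3 * r : ℕ) : ℝ) := by rw [hd3]; push_cast; ring
  have hMV := sq_le_of_laplace_one_eq_const hd1 y W σ hn hr' hN (le_of_eq h3r) hWlap x hx
  -- the mass of `W`
  have hGs := hGsum P hd k hk y (3 * r)
  have hWsum : ∑ z ∈ Finset.univ.filter (fun z : Site P 0 => (Site.tdist z y : ℝ) ≤ ((3 * r : ℕ) : ℝ)), W z ^ 2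
      ≤ 2 * 𝓜 + 2 * a ^ 2 * (CG * (((3 * r : ℕ) : ℝ) + 1)) := by
    have hpt : ∀ z, W z ^ 2 ≤ 2 * u z ^ 2 + 2 * a ^ 2 * g z ^ 2 := fun z => by
      have h : (u z - a * g z) ^ 2 ≤ 2 * u z ^ 2 + 2 * (a * g z) ^ 2 := by linarith only [sq_nonneg (u z + a * g z)]
      rw [mul_pow, ← mul_assoc] at h
      exact h
    refine (Finset.sum_le_sum fun z _ => hpt z).trans ?_
    rw [Finset.sum_add_distrib, ← Finset.mul_sum, ← Finset.mul_sum]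
    exact add_le_add (mul_le_mul_of_nonneg_left hM (by norm_num)) (mul_le_mul_of_nonneg_left hGs (by positivity))
  -- `|W x| ≤ √(…)`
  set RHS : ℝ := 4 * K * (2 * 𝓜 + 2 * a ^ 2 * (CG * (((3 * r : ℕ) : ℝ) + 1)))
      + (4 * K * (2 * (r : ℝ) + 1) ^ P.d + 2) * (64 * (2 : ℝ) ^ P.d * (P.d : ℝ) * (|σ| * ((r : ℝ) + 1) / (P.d : ℝ)) * (2 * (r : ℝ) + 1)) ^ 2
    with hRHS
  have hWx2 : W x ^ 2 ≤ RHS := by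
    rw [hRHS]
    refine hMV.trans (add_le_add ?_ le_rfl)
    calc 4 * ((2 : ℝ) ^ P.d * (1 + 56 * (P.d : ℝ)) ^ P.d / ((n : ℝ) + 1) ^ P.d) *
          ∑ z ∈ Finset.univ.filter (fun z : Site P 0 => (Site.tdist z y : ℝ) ≤ ((3 * r : ℕ) : ℝ)), W z ^ 2
        = 4 * K * ∑ z ∈ Finset.univ.filter (fun z : Site P 0 => (Site.tdist z y : ℝ) ≤ ((3 * r : ℕ) : ℝ)), W z ^ 2 := by rw [hK]
      _ ≤ 4 * K * (2 * 𝓜 + 2 * a ^ 2 * (CG * (((3 * r : ℕ) : ℝ) + 1))) := mul_le_mul_of_nonneg_left hWsum (by positivity)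
  have hWx : |W x| ≤ Real.sqrt RHS := by
    rw [← Real.sqrt_sq (abs_nonneg (W x)), sq_abs]; exact Real.sqrt_le_sqrt hWx2
  -- the cone
  have hcone : (Site.tdist x y : ℝ) * (|a| * |g x|) ≤ |a| * C₁ := by
    rcases eq_or_ne x y with hxy | hxy
    · rw [hxy, tdist_self]; simp only [Nat.cast_zero, zero_mul]; positivity
    · have h1 := hG1 P hd k hk y x hxy
      rw [tdist_comm] at h1
      calc (Site.tdist x y : ℝ) * (|a| * |g x|) = |a| * (|g x| * (Site.tdist x y : ℝ)) := by ring
        _ ≤ |a| * C₁ := mul_le_mul_of_nonneg_left (by rw [hgdef]; exact h1) (abs_nonneg _)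
  have haabs : |a| = |q| / (2 * c ^ 2) := by rw [ha, abs_div, abs_of_pos (by positivity : (0:ℝ) < 2 * c ^ 2)]
  -- assemble
  have eu : u x = a * g x + W x := by rw [hWdef]; ring
  calc (Site.tdist x y : ℝ) * |u x| = (Site.tdist x y : ℝ) * |a * g x + W x| := by rw [eu]
    _ ≤ (Site.tdist x y : ℝ) * (|a| * |g x| + |W x|) :=
        mul_le_mul_of_nonneg_left ((abs_add_le _ _).trans (by rw [abs_mul])) ht0
    _ = (Site.tdist x y : ℝ) * (|a| * |g x|) + (Site.tdist x y : ℝ) * |W x| := by ring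
    _ ≤ |a| * C₁ + (Site.tdist x y : ℝ) * Real.sqrt RHS := add_le_add hcone (mul_le_mul_of_nonneg_left hWx ht0)
    _ = |q| / (2 * c ^ 2) * C₁ + (Site.tdist x y : ℝ) * Real.sqrt RHS := by rw [haabs]

/-! ## §3 (PIN-abs at the scales of record) — px11 g3's (L1) «ABSTRACT-PIN» packaging (v1.1 append) -/

section Punctured

open B15DeterminingSets (embIter)

/-- `√(A + J) ≤ √a·√X + √b·Y + √g·Z` when `A ≤ aX + bY²`, `J ≤ gZ²` (all data nonnegative; `√(s+t) ≤ √s + √t` is lit ✓ `MRT2015.sqrt_add_le_sqrt_add_sqrt`,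
re-derived inline to keep the import closure inside the cell). [folklore] -/
theorem sqrt_le_three {A J a X b Y g Z : ℝ} (ha : 0 ≤ a) (hX : 0 ≤ X) (hb : 0 ≤ b) (hY : 0 ≤ Y) (hg : 0 ≤ g) (hZ : 0 ≤ Z)
    (hA0 : 0 ≤ A) (hJ0 : 0 ≤ J) (hA : A ≤ a * X + b * Y ^ 2) (hJ : J ≤ g * Z ^ 2) :
    Real.sqrt (A + J) ≤ Real.sqrt a * Real.sqrt X + Real.sqrt b * Y + Real.sqrt g * Z := by
  have hadd : ∀ s t : ℝ, 0 ≤ s → 0 ≤ t → Real.sqrt (s + t) ≤ Real.sqrt s + Real.sqrt t := by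
    intro s t hs ht
    have h1 : s + t ≤ (Real.sqrt s + Real.sqrt t) ^ 2 := by
      nlinarith [Real.sq_sqrt hs, Real.sq_sqrt ht, Real.sqrt_nonneg s, Real.sqrt_nonneg t]
    calc Real.sqrt (s + t) ≤ Real.sqrt ((Real.sqrt s + Real.sqrt t) ^ 2) := Real.sqrt_le_sqrt h1
      _ = Real.sqrt s + Real.sqrt t := Real.sqrt_sq (by positivity)
  have h1 : Real.sqrt A ≤ Real.sqrt a * Real.sqrt X + Real.sqrt b * Y := by
    refine (Real.sqrt_le_sqrt hA).trans ((hadd _ _ (by positivity) (by positivity)).trans (le_of_eq ?_))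
    rw [Real.sqrt_mul ha, Real.sqrt_mul hb, Real.sqrt_sq hY]
  have h2 : Real.sqrt J ≤ Real.sqrt g * Z := by
    refine (Real.sqrt_le_sqrt hJ).trans (le_of_eq ?_)
    rw [Real.sqrt_mul hg, Real.sqrt_sq hZ]
  linarith [hadd A J hA0 hJ0]

/-- `ℓ·√(X∕ℓ³) = √(X∕ℓ)` for `ℓ > 0`. [folklore] -/
theorem mul_sqrt_div_cube {ℓ X : ℝ} (hℓ : 0 < ℓ) : ℓ * Real.sqrt (X / ℓ ^ 3) = Real.sqrt (X / ℓ) := by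
  rw [← Real.sqrt_sq hℓ.le, ← Real.sqrt_mul (sq_nonneg ℓ), Real.sqrt_sq hℓ.le]
  congr 1
  field_simp

/-- the constant source of the corrected field: `|(κ + q·T⁻¹)∕1²| ≤ (ℓ²|κ| + |q|)∕ℓ²` when `ℓ³ ≤ T`, `ℓ ≥ 1`. [folklore] -/
theorem abs_source_le {κ q T ℓ : ℝ} (hℓ : 1 ≤ ℓ) (hT : ℓ ^ 3 ≤ T) :
    |(κ + q * T⁻¹) / 1 ^ 2| ≤ (ℓ ^ 2 * |κ| + |q| / ℓ) / ℓ ^ 2 := by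
  have hℓ0 : 0 < ℓ := by linarith
  have hT0 : 0 < T := lt_of_lt_of_le (by positivity) hT
  rw [one_pow, div_one, le_div_iff₀ (by positivity)]
  have h1 : |κ + q * T⁻¹| ≤ |κ| + |q| * T⁻¹ := by
    calc |κ + q * T⁻¹| ≤ |κ| + |q * T⁻¹| := abs_add_le _ _
      _ = |κ| + |q| * T⁻¹ := by rw [abs_mul, abs_of_pos (inv_pos.2 hT0)]
  have h2 : |q| * T⁻¹ * ℓ ^ 2 ≤ |q| / ℓ := by
    rw [le_div_iff₀ hℓ0, mul_assoc, mul_assoc]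
    refine mul_le_of_le_one_right (abs_nonneg _) ?_
    rw [show ℓ ^ 2 * ℓ = ℓ ^ 3 by ring, inv_mul_le_iff₀ hT0, mul_one]
    exact hT
  nlinarith [abs_nonneg κ]

/-- the closing bookkeeping: `Q∕2·C₁ + (C_a S + C_b Q + C_J (K + Q)) ≤ (C₁∕2 + C_a + C_b + C_J + 1)(S + Q + K)` for nonnegative data. [folklore] -/
theorem closing_le {C₁ Ca Cb CJ S Q K : ℝ} (h₁ : 0 ≤ C₁) (ha : 0 ≤ Ca) (hb : 0 ≤ Cb) (hJ : 0 ≤ CJ) (hS : 0 ≤ S) (hQ : 0 ≤ Q) (hK : 0 ≤ K) :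
    Q / 2 * C₁ + (Ca * S + Cb * Q + CJ * (K + Q)) ≤ (C₁ / 2 + Ca + Cb + CJ + 1) * (S + Q + K) := by
  nlinarith [mul_nonneg h₁ hS, mul_nonneg h₁ hK, mul_nonneg ha hQ, mul_nonneg ha hK, mul_nonneg hb hS, mul_nonneg hb hK, mul_nonneg hJ hS]

/-- on `Site P j` the `ℓ¹` distance vanishes only on the diagonal (via ✓ `supDist_le_tdist`, ✓ `supDist_eq_zero_iff`). [folklore] -/
theorem tdist_pos_of_ne {x y : Site P j} (h : x ≠ y) : 0 < Site.tdist x y := by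
  rcases Nat.eq_zero_or_pos (Site.tdist x y) with h0 | hpos
  · exfalso
    have hs : LatticeFieldCalculus.supDist x y = 0 :=
      Nat.eq_zero_of_le_zero (h0 ▸ B3TorusRadialSums.supDist_le_tdist x y)
    exact h ((B3TorusRadialSums.supDist_eq_zero_iff x y).1 hs)
  · exact hpos

set_option maxHeartbeats 400000 in
/-- ★★★ **(ABSTRACT-PIN, px11 g3's (L1) shape)**: there is an absolute `C_p > 0` such that for every record with `P.d = 3`, `k ≤ m + K`, `L^k ≥ 1024`, every centre
`y₀` (`y₀′ := embIter k y₀`), every REAL field `u` with `laplace 1 u z = κ` on the punctured ball `{0 < tdist(z, y₀′) < L^k∕2}`, and every mass bound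
`Σ_{tdist(z,y₀′) < L^k∕2} u z² ≤ 𝓜`:  for every `x` with `tdist(x, y₀′) ≤ 13(L^k∕1024) + 18`,
`tdist(x, y₀′)·|u x| ≤ C_p·(√(𝓜 ∕ L^k) + |laplace 1 u y₀′ − κ| + (L^k)³·|κ|)`
(§2 at `c = 1`, `n = ρ₀ = n₁ := 13(L^k∕1024)+18`, `r = 5n₁ + 6`; the three summands are the ball mass through the sourced mean value, the CHARGE `q = laplace 1 u y₀′ − κ` through
the cone `G̃ ≲ 1∕tdist` and the mass of `G̃`, and the constant source — `(L^k)³|κ|`, one power above the `(L^k)²` of the ask: `tdist ≤ n₁ ≍ ℓ` times the source junk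
`|σ|·r² ≍ |κ|ℓ²`; for the covariant chain `κ = O(ℓ⁻³)·(data)`, so the summand is `O(data)`). [cite: Balaban1985Variational, Prop. 7 p.299; Balaban1985RegularSpaces, (1.36) p.82] -/
theorem tdist_mul_abs_le_of_laplace_const_punctured : ∃ Cp : ℝ, 0 < Cp ∧
    ∀ (P : Params) (_ : P.d = 3) (k : ℕ) (_ : k ≤ P.m + P.K) (_ : 1024 ≤ P.L ^ k) (y₀ : Site P k) (u : SiteField P 0 ℝ) (κ : ℝ)
      (_ : ∀ z : Site P 0, 0 < Site.tdist z (embIter k y₀) → (Site.tdist z (embIter k y₀) : ℝ) < (P.L : ℝ) ^ k / 2 → laplace 1 u z = κ)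
      (𝓜 : ℝ) (_ : ∑ z ∈ Finset.univ.filter (fun z : Site P 0 => (Site.tdist z (embIter k y₀) : ℝ) < (P.L : ℝ) ^ k / 2), u z ^ 2 ≤ 𝓜)
      (x : Site P 0) (_ : Site.tdist x (embIter k y₀) ≤ 13 * (P.L ^ k / 1024) + 18),
      (Site.tdist x (embIter k y₀) : ℝ) * |u x|
        ≤ Cp * (Real.sqrt (𝓜 / (P.L : ℝ) ^ k) + |laplace 1 u (embIter k y₀) - κ| + ((P.L : ℝ) ^ k) ^ 3 * |κ|) := by
  obtain ⟨C₁, CG, hC₁, hCG, h⟩ := tdist_mul_abs_le_of_laplace_eq_const_off_centre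
  -- absolute constants
  set K0 : ℝ := 8 * 169 ^ 3 with hK0
  set Ca : ℝ := Real.sqrt (4 * (K0 * 158 ^ 3) * 2) with hCa
  set Cb : ℝ := Real.sqrt (4 * (K0 * 158 ^ 3) * (17 * CG / 2)) with hCb
  set CJ : ℝ := Real.sqrt (4 * (K0 * 1331) + 2) * 33792 with hCJ
  have hCJ0 : 0 ≤ CJ := by rw [hCJ]; positivity
  refine ⟨C₁ / 2 + Ca + Cb + CJ + 1, by positivity, ?_⟩
  intro P hd k hk hℓk y₀ u κ hu 𝓜 hM x hx
  classical
  obtain ⟨hq1, hq2, hq3, h9, h15, h158, hn1ℓ, h11, h12, h8⟩ := Prop7InterpErrorPinReaction.scales hℓk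
  set q₁ : ℕ := P.L ^ k / 1024 with hq₁
  set n₁ : ℕ := 13 * q₁ + 18 with hn₁
  set ℓ : ℝ := (P.L : ℝ) ^ k with hℓdef
  have hℓN : ((P.L ^ k : ℕ) : ℝ) = ℓ := by push_cast; rfl
  have hL1 : (1 : ℝ) ≤ (P.L : ℝ) := by exact_mod_cast P.L_pos
  have hℓ1 : 1 ≤ ℓ := one_le_pow₀ hL1
  have hℓ0 : 0 < ℓ := by linarith
  have hd3 : (P.d : ℝ) = 3 := by exact_mod_cast hd
  set y : Site P 0 := embIter k y₀ with hy
  have hn₁ℓ : (n₁ : ℝ) ≤ ℓ := by rw [← hℓN]; exact_mod_cast hn1ℓ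
  have h158ℓ : ℓ ≤ 158 * (n₁ : ℝ) := by rw [← hℓN]; exact_mod_cast h158
  have hn₁0 : (0 : ℝ) < n₁ := by rw [hn₁]; push_cast; linarith [(Nat.cast_nonneg q₁ : (0:ℝ) ≤ q₁)]
  have h18R : (18 : ℝ) ≤ n₁ := by exact_mod_cast (by omega : 18 ≤ n₁)
  have hM0 : 0 ≤ 𝓜 := le_trans (Finset.sum_nonneg fun _ _ => sq_nonneg _) hM
  -- §2's instance: `c = 1`, `n = ρ₀ = n₁`, `r = 5n₁ + 6`
  set r : ℕ := 5 * n₁ + 6 with hr5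
  have hr : r = n₁ + n₁ + 3 * (n₁ + 2) := by rw [hr5]; ring
  have hr5R : ((r : ℕ) : ℝ) = 5 * (n₁ : ℝ) + 6 := by rw [hr5]; push_cast; ring
  have h2N : 2 * P.L ^ k ≤ P.sitesPerDir 0 := by
    show 2 * P.L ^ k ≤ 2 * P.L ^ (P.m + P.K - 0)
    exact Nat.mul_le_mul_left 2 (Nat.pow_le_pow_right P.L_pos (by omega))
  have hN : 2 * (r + 1) < P.sitesPerDir 0 := by rw [hr5]; omega
  have hreg : 3 * ((r : ℝ) + 1) < ℓ / 2 := by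
    rw [hr5R, ← hℓN]
    have : ((2 * (15 * n₁ + 21) : ℕ) : ℝ) < ((P.L ^ k : ℕ) : ℝ) := by exact_mod_cast (by omega : 2 * (15 * n₁ + 21) < P.L ^ k)
    push_cast at this; linarith
  have hu' : ∀ z : Site P 0, (Site.tdist z y : ℝ) ≤ 3 * ((r : ℝ) + 1) → z ≠ y → laplace 1 u z = κ := by
    intro z hz hzy
    exact hu z (tdist_pos_of_ne hzy) (lt_of_le_of_lt hz hreg)
  have hball : ((3 * r : ℕ) : ℝ) < ℓ / 2 := by push_cast; linarith
  have hM' : ∑ z ∈ Finset.univ.filter (fun z : Site P 0 => (Site.tdist z y : ℝ) ≤ ((3 * r : ℕ) : ℝ)), u z ^ 2 ≤ 𝓜 := by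
    refine le_trans (Finset.sum_le_sum_of_subset_of_nonneg (fun z hz => ?_) fun _ _ _ => sq_nonneg _) hM
    rw [Finset.mem_filter] at hz ⊢
    exact ⟨hz.1, lt_of_le_of_lt hz.2 hball⟩
  have hmain := h P hd k hk 1 one_ne_zero y u κ n₁ n₁ r (by omega) hr hN hu' 𝓜 hM' x hx
  -- name the two pieces under the square root (they abstract inside `hmain`)
  set A : ℝ := 4 * ((2 : ℝ) ^ P.d * (1 + 56 * (P.d : ℝ)) ^ P.d / ((n₁ : ℝ) + 1) ^ P.d) *
      (2 * 𝓜 + 2 * ((laplace 1 u y - κ) / (2 * 1 ^ 2)) ^ 2 * (CG * (((3 * r : ℕ) : ℝ) + 1))) with hA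
  set J : ℝ := (4 * ((2 : ℝ) ^ P.d * (1 + 56 * (P.d : ℝ)) ^ P.d / ((n₁ : ℝ) + 1) ^ P.d) * (2 * (r : ℝ) + 1) ^ P.d + 2) *
      (64 * (2 : ℝ) ^ P.d * (P.d : ℝ) *
          (abs ((κ + (laplace 1 u y - κ) * (((P.L ^ k * P.sitesPerDir k : ℕ) : ℝ) ^ P.d)⁻¹) / 1 ^ 2) * ((r : ℝ) + 1) / (P.d : ℝ)) *
        (2 * (r : ℝ) + 1)) ^ 2 with hJ
  set q : ℝ := laplace 1 u y - κ with hqdef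
  set t : ℝ := (Site.tdist x y : ℝ) with ht
  have ht0 : 0 ≤ t := Nat.cast_nonneg _
  have htℓ : t ≤ ℓ := le_trans (by rw [ht]; exact_mod_cast hx) hn₁ℓ
  have hA0 : 0 ≤ A := by rw [hA]; positivity
  have hJ0 : 0 ≤ J := by rw [hJ]; positivity
  -- the numeric rows
  have hK : (2 : ℝ) ^ P.d * (1 + 56 * (P.d : ℝ)) ^ P.d / ((n₁ : ℝ) + 1) ^ P.d ≤ K0 * 158 ^ 3 / ℓ ^ 3 := by
    rw [hK0]; exact Prop7InterpErrorNearRow.mv_const_le P.d hd hn₁0 hℓ0 h158ℓ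
  have hK' : (2 : ℝ) ^ P.d * (1 + 56 * (P.d : ℝ)) ^ P.d / ((n₁ : ℝ) + 1) ^ P.d * (2 * (r : ℝ) + 1) ^ P.d ≤ K0 * 1331 := by
    rw [hK0]; exact Prop7InterpErrorNearRow.mv_const_mul_le P.d hd (by linarith) hr5R
  have hT1 : ℓ ^ 3 ≤ (((P.L ^ k * P.sitesPerDir k : ℕ) : ℝ)) ^ P.d := by
    rw [hd, ← hℓN]
    exact_mod_cast Nat.pow_le_pow_left (Nat.le_mul_of_pos_right _ (Nat.pos_of_ne_zero (P.sitesPerDir_ne_zero k))) 3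
  have hσle := abs_source_le (κ := κ) (q := q) hℓ1 hT1
  have hm : 64 * (2 : ℝ) ^ P.d * (P.d : ℝ) *
      (abs ((κ + q * (((P.L ^ k * P.sitesPerDir k : ℕ) : ℝ) ^ P.d)⁻¹) / 1 ^ 2) * ((r : ℝ) + 1) / (P.d : ℝ)) * (2 * (r : ℝ) + 1)
        ≤ 33792 * (ℓ ^ 2 * |κ| + |q| / ℓ) :=
    Prop7InterpErrorNearRow.source_const_le P.d hd hr5R h18R hn₁ℓ (by positivity) hσle
  have hℓ1024 : (1024 : ℝ) ≤ ℓ := by rw [← hℓN]; exact_mod_cast hℓk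
  have h3r1 : ((3 * r : ℕ) : ℝ) + 1 ≤ 17 * ℓ := by push_cast; rw [hr5R]; linarith only [hn₁ℓ, hℓ1024]
  have hA1 : A ≤ 4 * (K0 * 158 ^ 3) * 2 * (𝓜 / ℓ ^ 3) + 4 * (K0 * 158 ^ 3) * (17 * CG / 2) * (|q| / ℓ) ^ 2 := by
    have hsq : (|q| / ℓ) ^ 2 = q ^ 2 / ℓ ^ 2 := by rw [div_pow, sq_abs]
    rw [hsq, hA]
    have e1 : 4 * (K0 * 158 ^ 3) * 2 * (𝓜 / ℓ ^ 3) + 4 * (K0 * 158 ^ 3) * (17 * CG / 2) * (q ^ 2 / ℓ ^ 2)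
        = 4 * (K0 * 158 ^ 3 / ℓ ^ 3) * (2 * 𝓜 + 2 * (q / (2 * 1 ^ 2)) ^ 2 * (CG * (17 * ℓ))) := by field_simp
    rw [e1]
    have hq2 : 2 * (q / (2 * 1 ^ 2)) ^ 2 * (CG * (((3 * r : ℕ) : ℝ) + 1)) ≤ 2 * (q / (2 * 1 ^ 2)) ^ 2 * (CG * (17 * ℓ)) :=
      mul_le_mul_of_nonneg_left (mul_le_mul_of_nonneg_left h3r1 hCG) (by positivity)
    exact mul_le_mul (mul_le_mul_of_nonneg_left hK (by norm_num))
      (by linarith only [hq2]) (by positivity) (by positivity)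
  have hJ1 : J ≤ (4 * (K0 * 1331) + 2) * (33792 * (ℓ ^ 2 * |κ| + |q| / ℓ)) ^ 2 := by
    rw [hJ]
    exact mul_le_mul (by linarith only [hK']) (pow_le_pow_left₀ (by positivity) hm 2) (sq_nonneg _) (by positivity)
  have hsqrt : Real.sqrt (A + J) ≤ Ca * Real.sqrt (𝓜 / ℓ ^ 3) + Cb * (|q| / ℓ) + CJ * (ℓ ^ 2 * |κ| + |q| / ℓ) := by
    have := sqrt_le_three (by positivity) (by positivity) (by positivity) (by positivity) (by positivity) (by positivity) hA0 hJ0 hA1 hJ1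
    rw [hCa, hCb, hCJ]
    refine this.trans (le_of_eq ?_)
    ring
  -- assemble: `t ≤ ℓ`, `ℓ·√(𝓜∕ℓ³) = √(𝓜∕ℓ)`
  have hstep : t * Real.sqrt (A + J) ≤ Ca * Real.sqrt (𝓜 / ℓ) + Cb * |q| + CJ * (ℓ ^ 3 * |κ| + |q|) := by
    calc t * Real.sqrt (A + J) ≤ ℓ * (Ca * Real.sqrt (𝓜 / ℓ ^ 3) + Cb * (|q| / ℓ) + CJ * (ℓ ^ 2 * |κ| + |q| / ℓ)) :=
          mul_le_mul htℓ hsqrt (Real.sqrt_nonneg _) hℓ0.le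
      _ = Ca * (ℓ * Real.sqrt (𝓜 / ℓ ^ 3)) + (Cb * |q| + CJ * |q|) * (ℓ / ℓ) + CJ * (ℓ ^ 3 * |κ|) := by ring
      _ = Ca * Real.sqrt (𝓜 / ℓ) + Cb * |q| + CJ * (ℓ ^ 3 * |κ| + |q|) := by
          rw [mul_sqrt_div_cube hℓ0, div_self hℓ0.ne', mul_one]; ring
  have hone : |q| / (2 * 1 ^ 2) * C₁ = |q| / 2 * C₁ := by norm_num
  calc t * |u x| ≤ |q| / (2 * 1 ^ 2) * C₁ + t * Real.sqrt (A + J) := hmain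
    _ ≤ |q| / 2 * C₁ + (Ca * Real.sqrt (𝓜 / ℓ) + Cb * |q| + CJ * (ℓ ^ 3 * |κ| + |q|)) := by rw [hone]; exact add_le_add le_rfl hstep
    _ ≤ (C₁ / 2 + Ca + Cb + CJ + 1) * (Real.sqrt (𝓜 / ℓ) + |q| + ℓ ^ 3 * |κ|) :=
        closing_le hC₁ (Real.sqrt_nonneg _) (Real.sqrt_nonneg _) hCJ0 (Real.sqrt_nonneg _) (abs_nonneg _) (by positivity)

end Punctured

end Summit.QuantumFields.YangMills.Theorems.Prop7InterpErrorPinAbstract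

end
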